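import Summits.CriticalPhenomena.Ising3DConformalLimit.Theorems.HarmonicMomentsIsotropyTwoPointAsymptoticIsotropyOfDilution
import Summits.CriticalPhenomena.Ising3DConformalLimit.Theorems.HarmonicMomentsIsotropyTwoPointAsymptoticIsotropyDilutionShell

/-!
# Vague asymptotic isotropy of the critical `ℤ³` two-point function — the dilution line with a
# RADIAL regularity input:
# `HarmonicDilution → CorrelationLengthWindow → CriticalShellCharging → TwoPointAsymptoticIsotropy`
(route HarmonicMomentsIsotropy, support item stmt-CriticalPhenomena-6036 `TwoPointAsymptoticIsotropy`)

THE RESULT. `twoPointAsymptoticIsotropy_of_dilution_shellCharging`: harmonic dilution (route decl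
`HarmonicDilution`) + the `ξ₂`-window (route decl `CorrelationLengthWindow`) + SHELL CHARGING of the
critical two-point mass — for `0 < ρ₁ < ρ₂` there are `q, δ₀ > 0` with
`q ∑_{‖δx‖_∞ ≤ 1} ⟨σ₀σₓ⟩_{β_c} ≤ ∑_{ρ₁² ≤ δ²|x|² ≤ ρ₂²} ⟨σ₀σₓ⟩_{β_c}` for `0 < δ < δ₀` (a purely RADIAL,
doubling / Karamata-type regularity statement about `⟨σ₀σ_x⟩_{β_c}` on `ℤ³`: the critical mass of a
ball does not concentrate at its centre relative to any fixed Euclidean shell; "P4 at all scales" in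
the language of Aizenman–Duminil-Copin's regular scales) — imply the route decl
`TwoPointAsymptoticIsotropy` verbatim.  Compared with the cube-charging form
(`twoPointAsymptoticIsotropy_of_dilution_charging`, file `…OfDilution`) the ANGULAR part of the
regularity input is gone: it is produced by the mechanism itself.

THE PROOF (`nu_cube_charge_of_shellCharging`).  The core `tendsto_ratio_of_dilution_core` needs the
scaled subcritical measures `ν_β` to charge every small sup-norm cube `Q` away from the origin.
Suppose not: then `ν_{β_j}(Q) → 0` along some `β_j ↑ β_c`.  By `exists_invariant_weakLimit` (HD +
CLW (ii): Prokhorov, moments, Fischer, Carleman) a subsequence converges weakly to a probability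
measure `μ` invariant under every linear isometry of `ℝ³`; by the portmanteau theorem `μ(Q°) = 0`
(open cube) while `μ(F) ≥ ι₀ > 0` for the closed Euclidean shell `F = {|‖y‖ - |w|| ≤ r/2}` through
the middle of `Q`, which `ν_β` charges uniformly (`nu_shell_charge_of_shellCharging`, shell charging +
CLW (i)).  But every point of `F` is carried into `Q°` by a reflection (`exists_isometry_mem_cube`:
reflect `y` onto the ray through the centre of `Q`), so by compactness finitely many reflected copies
of `Q°` cover `F` and invariance gives `μ(F) ≤ K μ(Q°) = 0` (`measure_le_card_mul_of_invariant`) —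
a contradiction.

References: M. Campostrini, A. Pelissetto, P. Rossi, E. Vicari, Phys. Rev. E 57 (1998) 184, §2
[CampostriniEtAl1998]; M. Aizenman, H. Duminil-Copin, Ann. of Math. 194 (2021), Def. 5.11 (regular
scales, P4) [AizenmanDuminilCopinAnnals2021]; H. Duminil-Copin, ICM 2022, §8.1 [DuminilCopinICM2022].
No definitions, no named facts; axioms standard.
-/

noncomputable section

open MeasureTheory Filter Topology Set
open scoped ENNReal NNReal BigOperators
open Literature.Probability.LatticeModels

namespace Summit.CriticalPhenomena.Ising3DConformalLimit.Theorems.HarmonicMomentsIsotropy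

open scoped Classical

/-! ## Covering a shell by reflected cubes -/

/-- **Invariance and compactness.** For a measure on Euclidean `ℝ³` invariant under every linear
isometry, a compact set each of whose points is carried into the open set `U` by some linear isometry
has measure at most finitely many times `μ U`. -/
theorem measure_le_card_mul_of_invariant {μ : Measure V} (hμ : ∀ T : V ≃ₗᵢ[ℝ] V, μ.map T = μ)
    {F U : Set V} (hF : IsCompact F) (hU : IsOpen U)
    (hcover : ∀ y ∈ F, ∃ T : V ≃ₗᵢ[ℝ] V, T y ∈ U) :
    ∃ K : ℕ, μ F ≤ K * μ U := by
  obtain ⟨t, ht⟩ := hF.elim_finite_subcover (fun T : V ≃ₗᵢ[ℝ] V => T ⁻¹' U)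
    (fun T => hU.preimage T.continuous) (fun y hy => by
      obtain ⟨T, hT⟩ := hcover y hy
      exact Set.mem_iUnion.2 ⟨T, hT⟩)
  refine ⟨t.card, ?_⟩
  have hpre : ∀ T : V ≃ₗᵢ[ℝ] V, μ (T ⁻¹' U) = μ U := fun T => by
    rw [← Measure.map_apply T.continuous.measurable hU.measurableSet, hμ T]
  calc μ F ≤ μ (⋃ T ∈ t, T ⁻¹' U) := measure_mono ht
    _ ≤ ∑ T ∈ t, μ (T ⁻¹' U) := measure_biUnion_finset_le t _
    _ = ∑ T ∈ t, μ U := Finset.sum_congr rfl fun T _ => hpre T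
    _ = t.card * μ U := by rw [Finset.sum_const, nsmul_eq_mul]

/-- **Reflecting onto the central ray of a cube.** Every point `y` of Euclidean `ℝ³` whose norm is
within `r/2` of the Euclidean norm of `w` is carried by a reflection into the open sup-norm cube
`{‖z - w‖_∞ < r}` (`0 < r < ‖w‖_∞`): reflect `y` onto the point of the ray `ℝ₊ w` with the same
norm. -/
theorem exists_isometry_mem_cube (w : Fin 3 → ℝ) {r : ℝ} (hr : 0 < r) (hw : r < ‖w‖) (y : V)
    (hy : |‖y‖ - ‖(WithLp.toLp 2 w : V)‖| ≤ r / 2) :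
    ∃ T : V ≃ₗᵢ[ℝ] V, WithLp.ofLp (T y) ∈ Metric.ball w r := by
  set wV : V := WithLp.toLp 2 w with hwV
  have hwsup : ‖w‖ ≤ ‖wV‖ := norm_ofLp_le wV
  have hR₀ : 0 < ‖wV‖ := lt_of_lt_of_le (hr.trans hw) hwsup
  set ρ : ℝ := ‖y‖ with hρ
  set y' : V := (ρ / ‖wV‖) • wV with hy'
  have hρ0 : 0 ≤ ρ := norm_nonneg _
  have hny' : ‖y'‖ = ρ := by
    rw [hy', norm_smul, Real.norm_eq_abs, abs_of_nonneg (by positivity), div_mul_cancel₀ _ hR₀.ne']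
  refine ⟨(ℝ ∙ (y - y'))ᗮ.reflection, ?_⟩
  rw [Submodule.reflection_sub (show ‖y‖ = ‖y'‖ by rw [hny'])]
  rw [Metric.mem_ball, dist_eq_norm]
  have hdiff : WithLp.ofLp y' - w = (ρ / ‖wV‖ - 1) • w := by
    rw [hy', WithLp.ofLp_smul, sub_smul, one_smul]
  rw [hdiff, norm_smul, Real.norm_eq_abs]
  have h1 : |ρ / ‖wV‖ - 1| = |ρ - ‖wV‖| / ‖wV‖ := by
    rw [div_sub_one hR₀.ne', abs_div, abs_of_pos hR₀]
  rw [h1]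
  calc |ρ - ‖wV‖| / ‖wV‖ * ‖w‖ ≤ |ρ - ‖wV‖| / ‖wV‖ * ‖wV‖ := by gcongr
    _ = |ρ - ‖wV‖| := div_mul_cancel₀ _ hR₀.ne'
    _ ≤ r / 2 := hy
    _ < r := by linarith

/-! ## Cube charging of `ν_β` from shell charging -/

/-- **`ν_β` charges cubes once it charges the shells through their middle.** Under harmonic
dilution and CLW (ii), if the scaled subcritical measures `ν_β` give the closed Euclidean shell
`{|‖y‖ - |w|₂| ≤ r/2}` through the middle of the sup-norm cube `Q = {‖z - w‖_∞ ≤ r}`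
(`0 < r < ‖w‖_∞`) a mass bounded below as `β ↑ β_c`, then they give `Q` itself a mass bounded below as
`β ↑ β_c`.  (By contradiction through an `O(3)`-invariant weak limit, the portmanteau theorem and the
covering of the shell by reflected copies of `Q°`; see the file header.) -/
theorem nu_cube_charge_of_nu_shell
    (hHD : ∀ (n m : ℕ) (Y : MvPolynomial (Fin 3) ℝ), 1 ≤ n → Y.IsHomogeneous n →
      (∑ i : Fin 3, MvPolynomial.pderiv i (MvPolynomial.pderiv i Y)) = 0 →
      Tendsto (fun β => (∑' x : Site 3, MvPolynomial.eval (fun i => ((x i : ℤ) : ℝ)) Y *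
          Real.sqrt (∑ i, ((x i : ℤ) : ℝ) ^ 2) ^ (2 * m) * twoPointFree 3 β x) /
        (∑' x : Site 3, Real.sqrt (∑ i, ((x i : ℤ) : ℝ) ^ 2) ^ (n + 2 * m) * twoPointFree 3 β x))
        (𝓝[<] (criticalBeta 3)) (𝓝 0))
    {c₀ C β₀ : ℝ} (hc₀ : 0 < c₀) (hβ₀ : β₀ < criticalBeta 3)
    (hii : ∀ β : ℝ, β₀ ≤ β → β < criticalBeta 3 → ∀ A : ℝ, 1 ≤ A →
      (∑' x : Site 3, if A ^ 2 * msq β < (∑ i, ((x i : ℤ) : ℝ) ^ 2) * chi β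
        then twoPointFree 3 β x else 0) ≤ C * Real.exp (-(c₀ * A)) * chi β)
    (w : Fin 3 → ℝ) {r : ℝ} (hr : 0 < r) (hw : r < ‖w‖) {ι₀ : ℝ} (hι₀ : 0 < ι₀)
    (hshell : ∀ᶠ β in 𝓝[<] (criticalBeta 3), ι₀ ≤ ((nu β) {y : V |
      ‖(WithLp.toLp 2 w : V)‖ - r / 2 ≤ ‖y‖ ∧ ‖y‖ ≤ ‖(WithLp.toLp 2 w : V)‖ + r / 2}).toReal) :
    ∃ ι > 0, ∀ᶠ β in 𝓝[<] (criticalBeta 3),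
      ι ≤ ((nu β) {y | WithLp.ofLp y ∈ Metric.closedBall w r}).toReal := by
  set wV : V := WithLp.toLp 2 w with hwV
  set R₀ : ℝ := ‖wV‖ with hR₀def
  -- the closed shell, the open cube, the closed cube
  set F : Set V := {y : V | R₀ - r / 2 ≤ ‖y‖ ∧ ‖y‖ ≤ R₀ + r / 2} with hF
  set U : Set V := {y : V | WithLp.ofLp y ∈ Metric.ball w r} with hU
  set Q : Set V := {y : V | WithLp.ofLp y ∈ Metric.closedBall w r} with hQ
  have hUQ : U ⊆ Q := fun y hy => Metric.ball_subset_closedBall hy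
  have hFclosed : IsClosed F :=
    (isClosed_le continuous_const continuous_norm).inter (isClosed_le continuous_norm continuous_const)
  have hFcpt : IsCompact F := by
    refine Metric.isCompact_of_isClosed_isBounded hFclosed ?_
    refine (Metric.isBounded_closedBall (x := (0 : V)) (r := R₀ + r / 2)).subset fun y hy => ?_
    rw [Metric.mem_closedBall, dist_zero_right]
    exact hy.2
  have hUopen : IsOpen U := Metric.isOpen_ball.preimage (PiLp.continuous_ofLp 2 _)
  by_contra H
  -- a sequence `β_n ↑ β_c` with `ν_{β_n}(Q) < 1/(n+1)`
  have hfreq : ∀ n : ℕ, ∃ β : ℝ, β ∈ Ioo (criticalBeta 3 - 1 / ((n : ℝ) + 1)) (criticalBeta 3) ∧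
      ((nu β) Q).toReal < 1 / ((n : ℝ) + 1) := by
    intro n
    have h1 : ¬ ∀ᶠ β in 𝓝[<] (criticalBeta 3), 1 / ((n : ℝ) + 1) ≤ ((nu β) Q).toReal :=
      fun h => H ⟨1 / ((n : ℝ) + 1), by positivity, h⟩
    have h2 : ∃ᶠ β in 𝓝[<] (criticalBeta 3), ((nu β) Q).toReal < 1 / ((n : ℝ) + 1) := by
      simpa only [not_eventually, not_le] using h1
    have h3 : ∀ᶠ β in 𝓝[<] (criticalBeta 3),
        β ∈ Ioo (criticalBeta 3 - 1 / ((n : ℝ) + 1)) (criticalBeta 3) :=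
      Ioo_mem_nhdsLT (sub_lt_self _ (by positivity))
    obtain ⟨β, hβQ, hβI⟩ := (h2.and_eventually h3).exists
    exact ⟨β, hβI, hβQ⟩
  choose ns hnsI hnsQ using hfreq
  have hns : Tendsto ns atTop (𝓝[<] (criticalBeta 3)) := by
    rw [tendsto_nhdsWithin_iff]
    refine ⟨?_, Eventually.of_forall fun n => (hnsI n).2⟩
    have hlow : Tendsto (fun n : ℕ => criticalBeta 3 - 1 / ((n : ℝ) + 1)) atTop
        (𝓝 (criticalBeta 3)) := by
      have := (tendsto_const_nhds :
        Tendsto (fun _ : ℕ => criticalBeta 3) atTop (𝓝 (criticalBeta 3))).sub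
        (tendsto_one_div_add_atTop_nhds_zero_nat (𝕜 := ℝ))
      simpa using this
    exact tendsto_of_tendsto_of_tendsto_of_le_of_le hlow tendsto_const_nhds
      (fun n => (hnsI n).1.le) (fun n => (hnsI n).2.le)
  obtain ⟨J, φ', μs, μ, hφ', hμs, hlim, hinv⟩ := exists_invariant_weakLimit hHD hc₀ hβ₀ hii hns
  have hsub : Tendsto (fun j => ns (J + φ' j)) atTop (𝓝[<] (criticalBeta 3)) :=
    hns.comp (tendsto_atTop_mono (fun j => Nat.le_add_left _ _) hφ'.tendsto_atTop)
  -- the closed shell keeps its mass in the limit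
  have hevF : ∀ᶠ j in atTop, ENNReal.ofReal ι₀ ≤ ((μs j : ProbabilityMeasure V) : Measure V) F := by
    filter_upwards [hsub.eventually hshell] with j hj
    rw [hμs j]
    exact ENNReal.ofReal_le_of_le_toReal hj
  have hμF : ENNReal.ofReal ι₀ ≤ (μ : Measure V) F :=
    (le_limsup_of_frequently_le' hevF.frequently).trans
      (ProbabilityMeasure.limsup_measure_closed_le_of_tendsto hlim hFclosed)
  -- the open cube loses its mass in the limit
  have hμU : (μ : Measure V) U = 0 := by
    have h1 := ProbabilityMeasure.le_liminf_measure_open_of_tendsto hlim hUopen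
    have hzero : Tendsto (fun j => ((μs j : ProbabilityMeasure V) : Measure V) U) atTop (𝓝 0) := by
      have hup : Tendsto (fun j => ENNReal.ofReal (1 / (((J + φ' j : ℕ) : ℝ) + 1))) atTop
          (𝓝 0) := by
        rw [← ENNReal.ofReal_zero]
        refine ENNReal.tendsto_ofReal ?_
        exact (tendsto_one_div_add_atTop_nhds_zero_nat (𝕜 := ℝ)).comp
          (tendsto_atTop_mono (fun j => Nat.le_add_left _ _) hφ'.tendsto_atTop)
      refine tendsto_of_tendsto_of_tendsto_of_le_of_le tendsto_const_nhds hup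
        (fun j => zero_le) (fun j => ?_)
      rw [hμs j]
      calc (nu (ns (J + φ' j))) U ≤ (nu (ns (J + φ' j))) Q := measure_mono hUQ
        _ ≤ ENNReal.ofReal (1 / (((J + φ' j : ℕ) : ℝ) + 1)) := by
            refine ((ENNReal.lt_ofReal_iff_toReal_lt ?_).2 (hnsQ (J + φ' j))).le
            rw [← hμs j]
            exact measure_ne_top _ _
    have h2 := hzero.liminf_eq
    rw [h2] at h1
    exact le_antisymm h1 zero_le
  -- covering: `μ F ≤ K μ U = 0`, contradiction
  obtain ⟨K, hK⟩ := measure_le_card_mul_of_invariant hinv hFcpt hUopen (fun y hy => by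
    refine exists_isometry_mem_cube w hr hw y ?_
    rw [abs_le]
    obtain ⟨h1, h2⟩ := hy
    constructor <;> linarith)
  rw [hμU, mul_zero] at hK
  have h0 : ENNReal.ofReal ι₀ ≤ 0 := hμF.trans hK
  rw [nonpos_iff_eq_zero, ENNReal.ofReal_eq_zero] at h0
  linarith

/-- **`ν_β` charges cubes, from shell charging of the critical mass.** Under harmonic dilution, both
halves of the `ξ₂`-window and SHELL charging of the critical two-point mass, every sup-norm cube
`{‖z - w‖_∞ ≤ r}` with `0 < r < ‖w‖_∞` and `9(‖w‖_∞ + r)² ≤ s₁` has `ν_β`-mass bounded below as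
`β ↑ β_c` — the charging hypothesis of `tendsto_ratio_of_dilution_core`
(`nu_shell_charge_of_shellCharging` + `nu_cube_charge_of_nu_shell`). -/
theorem nu_cube_charge_of_shellCharging
    (hHD : ∀ (n m : ℕ) (Y : MvPolynomial (Fin 3) ℝ), 1 ≤ n → Y.IsHomogeneous n →
      (∑ i : Fin 3, MvPolynomial.pderiv i (MvPolynomial.pderiv i Y)) = 0 →
      Tendsto (fun β => (∑' x : Site 3, MvPolynomial.eval (fun i => ((x i : ℤ) : ℝ)) Y *
          Real.sqrt (∑ i, ((x i : ℤ) : ℝ) ^ 2) ^ (2 * m) * twoPointFree 3 β x) /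
        (∑' x : Site 3, Real.sqrt (∑ i, ((x i : ℤ) : ℝ) ^ 2) ^ (n + 2 * m) * twoPointFree 3 β x))
        (𝓝[<] (criticalBeta 3)) (𝓝 0))
    (hS : ∀ ρ₁ ρ₂ : ℝ, 0 < ρ₁ → ρ₁ < ρ₂ → ∃ q : ℝ, 0 < q ∧ ∃ δ₀ : ℝ, 0 < δ₀ ∧
      ∀ δ : ℝ, 0 < δ → δ < δ₀ →
        q * (∑' x : Site 3, if (δ • fun i => ((x i : ℤ) : ℝ)) ∈
            Metric.closedBall (0 : Fin 3 → ℝ) 1 then criticalTwoPoint 3 x else 0) ≤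
          ∑' x : Site 3, (if ρ₁ ^ 2 ≤ δ ^ 2 * (∑ i, ((x i : ℤ) : ℝ) ^ 2) ∧
            δ ^ 2 * (∑ i, ((x i : ℤ) : ℝ) ^ 2) ≤ ρ₂ ^ 2 then criticalTwoPoint 3 x else 0))
    {s₁ β₁ : ℝ} (hβ₁ : β₁ < criticalBeta 3)
    (hi : ∀ β : ℝ, β₁ ≤ β → β < criticalBeta 3 → ∀ x : Site 3,
      (∑ i, ((x i : ℤ) : ℝ) ^ 2) * chi β ≤ s₁ * msq β →
        (1 / 2 : ℝ) * criticalTwoPoint 3 x ≤ twoPointFree 3 β x)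
    {c₀ C β₀ : ℝ} (hc₀ : 0 < c₀) (hβ₀ : β₀ < criticalBeta 3)
    (hii : ∀ β : ℝ, β₀ ≤ β → β < criticalBeta 3 → ∀ A : ℝ, 1 ≤ A →
      (∑' x : Site 3, if A ^ 2 * msq β < (∑ i, ((x i : ℤ) : ℝ) ^ 2) * chi β
        then twoPointFree 3 β x else 0) ≤ C * Real.exp (-(c₀ * A)) * chi β)
    (w : Fin 3 → ℝ) {r : ℝ} (hr : 0 < r) (hw : r < ‖w‖) (hws : 9 * (‖w‖ + r) ^ 2 ≤ s₁) :
    ∃ ι > 0, ∀ᶠ β in 𝓝[<] (criticalBeta 3),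
      ι ≤ ((nu β) {y | WithLp.ofLp y ∈ Metric.closedBall w r}).toReal := by
  set wV : V := WithLp.toLp 2 w with hwV
  set R₀ : ℝ := ‖wV‖ with hR₀def
  have hwsup : ‖w‖ ≤ R₀ := norm_ofLp_le wV
  have hwpos : 0 < ‖w‖ := hr.trans hw
  have hR₀le : R₀ ≤ 2 * ‖w‖ := by
    have h3 : R₀ ^ 2 ≤ 3 * ‖w‖ ^ 2 := by
      rw [hR₀def, hwV, EuclideanSpace.norm_eq, Real.sq_sqrt (Finset.sum_nonneg fun _ _ => sq_nonneg _)]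
      have := sum_sq_le_three_mul_norm_sq w
      refine le_trans (le_of_eq ?_) this
      simp
    nlinarith [norm_nonneg wV, norm_nonneg w]
  have hρ₁ : 0 < R₀ - r / 2 := by linarith
  have hρ₂ : (R₀ + r / 2) ^ 2 ≤ s₁ := by
    have h1 : R₀ + r / 2 ≤ 3 * (‖w‖ + r) := by linarith
    have h2 : 0 ≤ R₀ + r / 2 := by linarith
    nlinarith
  obtain ⟨ι₀, hι₀, hshell⟩ := nu_shell_charge_of_shellCharging hS hβ₁ hi hc₀ hβ₀ hii hρ₁
    (by linarith) hρ₂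
  exact nu_cube_charge_of_nu_shell hHD hc₀ hβ₀ hii w hr hw hι₀ hshell

end Summit.CriticalPhenomena.Ising3DConformalLimit.Theorems.HarmonicMomentsIsotropy

/-! ## The dilution line with shell charging -/

namespace Summit.CriticalPhenomena.Ising3DConformalLimit.HarmonicMomentsIsotropyTwoPoint

open Summit.CriticalPhenomena.Ising3DConformalLimit.Theorems.HarmonicMomentsIsotropy
open Summit.CriticalPhenomena.Ising3DConformalLimit.Theses.HarmonicMomentsIsotropy
open scoped Classical

/-- **`HarmonicDilution → CorrelationLengthWindow → CriticalShellCharging → TwoPointAsymptoticIsotropy`.**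
If every cubic-harmonic anisotropy ratio of the subcritical two-point function on `ℤ³` tends to `0`
as `β ↑ β_c` (route decl `HarmonicDilution`), the `ξ₂`-window holds (route decl
`CorrelationLengthWindow`), and the critical two-point mass charges Euclidean shells — for
`0 < ρ₁ < ρ₂` there are `q > 0`, `δ₀ > 0` with
`q ∑_{‖δx‖_∞ ≤ 1} ⟨σ₀σₓ⟩_{β_c} ≤ ∑_{ρ₁² ≤ δ²|x|² ≤ ρ₂²} ⟨σ₀σₓ⟩_{β_c}` for `0 < δ < δ₀` (a radial
regularity statement only) — then for every continuous compactly supported `φ ≥ 0`, `φ ≢ 0`, on `ℝ³`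
and every orthogonal `R`, `∑ₓ φ(Rx/L)⟨σ₀σₓ⟩_{β_c} / ∑ₓ φ(x/L)⟨σ₀σₓ⟩_{β_c} → 1` as `L → ∞` (route decl
`TwoPointAsymptoticIsotropy` verbatim).  No scaling limit and no reflection positivity are used; the
angular regularity is produced by the `O(3)`-invariance of the weak limits of `ν_β`.
[cite: CampostriniEtAl1998, §2] [cite: AizenmanDuminilCopinAnnals2021, Def. 5.11] -/
theorem twoPointAsymptoticIsotropy_of_dilution_shellCharging (hHD : HarmonicDilution)
    (hCLW : CorrelationLengthWindow)
    (hS : ∀ ρ₁ ρ₂ : ℝ, 0 < ρ₁ → ρ₁ < ρ₂ → ∃ q : ℝ, 0 < q ∧ ∃ δ₀ : ℝ, 0 < δ₀ ∧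
      ∀ δ : ℝ, 0 < δ → δ < δ₀ →
        q * (∑' x : Site 3, if (δ • fun i => ((x i : ℤ) : ℝ)) ∈
            Metric.closedBall (0 : Fin 3 → ℝ) 1 then criticalTwoPoint 3 x else 0) ≤
          ∑' x : Site 3, (if ρ₁ ^ 2 ≤ δ ^ 2 * (∑ i, ((x i : ℤ) : ℝ) ^ 2) ∧
            δ ^ 2 * (∑ i, ((x i : ℤ) : ℝ) ^ 2) ≤ ρ₂ ^ 2 then criticalTwoPoint 3 x else 0)) :
    TwoPointAsymptoticIsotropy := by
  intro φ hφc hφs hφ0 hφpos R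
  have hHD' : ∀ (n m : ℕ) (Y : MvPolynomial (Fin 3) ℝ), 1 ≤ n → Y.IsHomogeneous n →
      (∑ i : Fin 3, MvPolynomial.pderiv i (MvPolynomial.pderiv i Y)) = 0 →
      Tendsto (fun β => (∑' x : Site 3, MvPolynomial.eval (fun i => ((x i : ℤ) : ℝ)) Y *
          Real.sqrt (∑ i, ((x i : ℤ) : ℝ) ^ 2) ^ (2 * m) * twoPointFree 3 β x) /
        (∑' x : Site 3, Real.sqrt (∑ i, ((x i : ℤ) : ℝ) ^ 2) ^ (n + 2 * m) * twoPointFree 3 β x))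
        (𝓝[<] (criticalBeta 3)) (𝓝 0) := hHD
  obtain ⟨hi, c₀, C, hc₀, β₀, hβ₀, hii⟩ := hCLW
  change ∀ ε : ℝ, 0 < ε → ∃ s : ℝ, 0 < s ∧ ∃ β₁ : ℝ, β₁ < criticalBeta 3 ∧
      ∀ β : ℝ, β₁ ≤ β → β < criticalBeta 3 → ∀ x : Site 3,
        (∑ i, ((x i : ℤ) : ℝ) ^ 2) * chi β ≤ s * msq β →
          (1 - ε) * criticalTwoPoint 3 x ≤ twoPointFree 3 β x at hi
  change ∀ β : ℝ, β₀ ≤ β → β < criticalBeta 3 → ∀ A : ℝ, 1 ≤ A →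
      (∑' x : Site 3, if A ^ 2 * msq β < (∑ i, ((x i : ℤ) : ℝ) ^ 2) * chi β
        then twoPointFree 3 β x else 0) ≤ C * Real.exp (-(c₀ * A)) * chi β at hii
  obtain ⟨s₁, hs₁, β₁, hβ₁, hi1⟩ := hi (1 / 2) (by norm_num)
  have hi1' : ∀ β : ℝ, β₁ ≤ β → β < criticalBeta 3 → ∀ x : Site 3,
      (∑ i, ((x i : ℤ) : ℝ) ^ 2) * chi β ≤ s₁ * msq β →
        (1 / 2 : ℝ) * criticalTwoPoint 3 x ≤ twoPointFree 3 β x := fun β h1 h2 x hx =>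
    calc (1 / 2 : ℝ) * criticalTwoPoint 3 x = (1 - 1 / 2) * criticalTwoPoint 3 x := by norm_num
      _ ≤ twoPointFree 3 β x := hi1 β h1 h2 x hx
  exact tendsto_ratio_of_dilution_core hHD' hi hc₀ hβ₀ hii hs₁
    (fun w r hr hrw hws => nu_cube_charge_of_shellCharging hHD' hS hβ₁ hi1' hc₀ hβ₀ hii w hr hrw hws)
    hφc hφs hφ0 hφpos R

end Summit.CriticalPhenomena.Ising3DConformalLimit.HarmonicMomentsIsotropyTwoPoint

end
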